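import Summits.AtomisticToContinuum.HydrodynamicLimit.Theorems.OneFlightGossipEngineEnergyCurrentTailsFirstPartnerObjects
import Summits.AtomisticToContinuum.HydrodynamicLimit.Theorems.OneFlightGossipEngineEnergyCurrentTailsLevelCensusSplitFloorRung0TubeMean
import Summits.AtomisticToContinuum.HydrodynamicLimit.Theorems.OneFlightGossipEngineEnergyCurrentTailsLevelCensusSplitFloorRung0Statics
import Summits.AtomisticToContinuum.HydrodynamicLimit.Theorems.JParityClosureRateFloorWindowFloorRung0
import Summits.AtomisticToContinuum.HydrodynamicLimit.Theorems.JParityClosureOddContactSymmetryGibbsInvariance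
import HarnessLib

/-!
# Seat c7 (lead), crux `EnergyCurrentTails` (stmt-AtomisticToContinuum-9235), line `quartic-schur-ledger`:
# the RUNG-0 certificate of the registered primitive T′ `stub_firstPartnerFloor` (`FirstPartnerFloorMeso`)
# — helper stub STATEMENTS (registered by `stub-add`; proved by the wave; sorries only here).

Rung 0 = constant profiles `(a, u, θ)`: the homogeneous drifted Gibbs law `G_N` is invariant under every
hard-sphere flow (`map_flow_localGibbsLaw_const`), so T′ at rung 0 is a STATIC statement about the hard-sphere
Gibbs point field at the MESOSCOPIC scale (look-ahead `τ₁ h_N = κ ε_N`, `κ = τ₁/σ` diameters of flight):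

* H1 `firstPartnerRung0_pathwise` (sure): the truncated static tube double sum of the band mixing mark is
  dominated by `(N+1) · firstPartnerSum` plus `C_K ×` the number of would-be pairs of out-degree `≥ 2`
  (a strict-tube pair with nonvanishing truncated mark is a would-be pair whose predicted impact datum IS the
  tube's impact normal — `RateFloorTubeBridge` / `RateFloorWindowFloor.tubeSum_trunc_le_wouldBeSum`; a would-be
  pair of out-degree one within `κε ≤ Δ` is a FIRST pair within `Δ`);
* H2 `firstPartnerRung0_excess` (3-label Ruelle statics, N-UNIFORM per particle): the out-degree-≥-2 count has a
  measurable majorant of Gibbs mean `≤ 4096 (N+1)³ ε_N⁴ h² (‖u‖² + 3θ)` (`= O(σ⁴κ²)·(N+1)` at `h = κ ε_N`);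
* H5 `firstPartnerRung0_markPositive`: the sphere-integrated band mixing mark has positive Maxwellian mean;
* H3 = c2's landed `EnergyCurrentTailsLevelCensus.sum_pair_tubeMark_mean_ge_of_measurable` (no new stub);
* target `stub_firstPartnerFloorRung0` = T′ `FirstPartnerFloorMeso` at constant profiles (K₀ = K₁ = 1).
-/

noncomputable section

open scoped BigOperators Classical ENNReal InnerProductSpace
open MeasureTheory Set
open Literature.Analysis.FluidPDE Literature.MathematicalPhysics.KineticTheory
  Literature.MathematicalPhysics.StatisticalMechanics

namespace Summit.AtomisticToContinuum.HydrodynamicLimit.Theorems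

namespace QuarticSchurLedger

open EnergyCurrentTailsFirstPartner RateFloorLine

/-- **H1 · pathwise transfer: band tube sum ≤ (N+1)·first-partner sum + C_K·(out-degree ≥ 2 count).** -/
theorem firstPartnerRung0_pathwise : ∀ (N : ℕ) (ε κ Δ K₀ K₁ K₂ s : ℝ), 0 < ε → 0 ≤ κ → κ * ε ≤ Δ → 0 ≤ K₁ → 0 ≤ K₂ → ε * (1 + 2 * κ * (K₁ + K₂ + 1)) < 1 / 2 → ∀ z : Config (N + 1) (Fin 3) T3, (∑ i : Fin (N + 1), ∑ j : Fin (N + 1), (if i ≠ j then pairTubeMark ε κ (fun q : V3 × V3 × V3 => if K₀ < ‖q.2.1‖ ∧ ‖q.2.1‖ ≤ K₂ ∧ ‖q.2.2‖ ≤ K₁ then 2 * (‖(reflectVel q.1 (q.2.1, q.2.2)).1‖ ^ 2 * ‖(reflectVel q.1 (q.2.1, q.2.2)).2‖ ^ 2) else 0) i j (fun m => (z m).1) (fun m => (z m).2) else 0)) ≤ ((N + 1 : ℕ) : ℝ) * firstPartnerSum ε Δ z s (mixMark N K₀ K₁) + (K₂ ^ 2 + K₁ ^ 2) ^ 2 /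 2 * (((wouldBePairs ε (κ * ε) z).filter fun p => ∃ q ∈ wouldBePairs ε (κ * ε) z, q.1 = p.1 ∧ q ≠ p).card : ℝ) := by
  sorry

/-- **H2 · 3-label statics: the out-degree-≥-2 would-be count is second order, N-uniformly per particle.** -/
theorem firstPartnerRung0_excess : ∀ (σ : ℝ), 0 < σ → σ ≤ 1 / 2 → SmallDensity uniformProfile σ → ∀ (a θ : ℝ), 0 < a → 0 < θ → ∀ (u : V3) (N : ℕ) (Φ : HardSphereFlow (Torus.geometry (Fin 3)) (hsDiameter σ N) (N + 1)) (h : ℝ), 0 < h → ∃ M : Config (N + 1) (Fin 3) T3 → ℝ≥0∞, Measurable M ∧ (∀ w ∈ hardSphereDomain (Torus.geometry (Fin 3)) (N + 1) (hsDiameter σ N), ((((wouldBePairs (hsDiameter σ N) h w).filter fun p => ∃ q ∈ wouldBePairs (hsDiameter σ N) h w, q.1 = p.1 ∧ q ≠ p).card : ℕ) : ℝ≥0∞) ≤ M w) ∧ ∫⁻ w, M w ∂(localGibbsLaw σ (fun _ => a) (fun _ => u) (fun _ => θ) N Φ) ≤ ENNReal.ofReal (4096 * (((N + 1 : ℕ)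 : ℝ) ^ 3 * (hsDiameter σ N ^ 4 * h ^ 2 * (‖u‖ ^ 2 + 3 * θ)))) := by
  sorry

/-- **H5 · positivity of the Maxwellian mean of the sphere-integrated band mixing mark (K₀ = K₁ = 1, K₂ = 3).** -/
theorem firstPartnerRung0_markPositive : ∀ (θ : ℝ) (u : V3), 0 < θ → 0 < ∫ p : V3 × V3, sphereMark (fun q : V3 × V3 × V3 => if 1 < ‖q.2.1‖ ∧ ‖q.2.1‖ ≤ 3 ∧ ‖q.2.2‖ ≤ 1 then 2 * (‖(reflectVel q.1 (q.2.1, q.2.2)).1‖ ^ 2 * ‖(reflectVel q.1 (q.2.1, q.2.2)).2‖ ^ 2) else 0) p.1 p.2 * (localMaxwellian 1 θ u p.1 * localMaxwellian 1 θ u p.2) := by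
  sorry

/-- **Target · RUNG 0 of T′ `FirstPartnerFloorMeso`: constant profiles, every flow family, all times.** -/
theorem stub_firstPartnerFloorRung0 : ∀ (a θb : ℝ) (u : V3), 0 < a → 0 < θb → ∃ σ₀ : ℝ, 0 < σ₀ ∧ ∀ σ : ℝ, 0 < σ → σ < σ₀ → ∀ T : ℝ, 0 < T → ∀ Φ : ((N : ℕ) → HardSphereFlow (Torus.geometry (Fin 3)) (hsDiameter σ N) (N + 1)), ∃ K₀ : ℝ, 0 ≤ K₀ ∧ ∃ K₁ : ℝ, ∃ τ₀ : ℝ, 0 < τ₀ ∧ ∀ τ₁ : ℝ, 0 < τ₁ → τ₁ ≤ τ₀ → ∃ c : ℝ, 0 < c ∧ ∃ N₀ : ℕ, ∀ N : ℕ, N₀ ≤ N → ∀ r : ℝ, 0 ≤ r → r ≤ T → ENNReal.ofReal (c * (σ ^ 2 * ((N + 1 : ℕ) : ℝ) ^ ((1 : ℝ) / 3)) * (τ₁ * ((N : ℝ) + 1) ^ (-(1 / 3 : ℝ)))) * (∫⁻ z, ENNReal.ofReal (fastQuarticAvg N K₀ ((Φ N).flow r z)) ∂(localGibbsLaw σ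 (fun _ => a) (fun _ => u) (fun _ => θb) N (Φ N))) ≤ ∫⁻ z, ENNReal.ofReal (firstPartnerSum (hsDiameter σ N) (τ₁ * ((N : ℝ) + 1) ^ (-(1 / 3 : ℝ))) ((Φ N).flow r z) r (mixMark N K₀ K₁)) ∂(localGibbsLaw σ (fun _ => a) (fun _ => u) (fun _ => θb) N (Φ N)) := by
  sorry

/-- Sanity: the rung-0 target is LITERALLY T′ at constant profiles (so the certificate is an instance of the stub). -/
example (h : FirstPartnerFloorMeso) : type_of% stub_firstPartnerFloorRung0 :=
  fun a θb u ha hθ => h (fun _ => a) (fun _ => θb) (fun _ => u) continuous_const continuous_const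
    continuous_const (fun _ => ha) (fun _ => hθ)

end QuarticSchurLedger

end Summit.AtomisticToContinuum.HydrodynamicLimit.Theorems

end
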